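import Literature.MathematicalPhysics.QuantumFieldTheory.Balaban1983to89.B9Cor35CDirCarrierAtOne

/-!
# `Balaban1983to89.B9Cor35CDirPaddedCarrier` — [Balaban1985BackgroundPropagators] p. 394 ∕ p. 409 l. 1–5, THE DIRICHLET COMPRESSION AS A CARRIER ISOMORPHISM:
# def-Y's padded local inverse `dirInvY 𝟙_𝔖 X = 𝟙_𝔖(𝟙_𝔖X𝟙_𝔖 + 1 − 𝟙_𝔖)⁻¹𝟙_𝔖` READ ON THE CARRIER `𝔖` is the genuine inverse of `X|_𝔖` — so Theorem 3.4's inverse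
# `Tinv` on `𝔖 × ι` (FILE `B9Cor35CDirEngineAtCarrier`) IS def-Y's third cube letter `C_□(Ṽ)` read there (`CinvR Ṽ`), by uniqueness of two-sided inverses
# (ROAD (I) U6b-iv, part 1; seat dag-n06-c g33)

statement-level skeleton of published theorems with citation tags; proofs where landed; nothing here is a claim about the Yang–Mills mass gap

## What this file does (mathematically)

[Balaban1985BackgroundPropagators] p. 394 defines the Dirichlet operators by compression («Δ′_a↾Ω₀ = Ω₀Δ′_aΩ₀ … Its inverse is denoted by G′») and
p. 409 l. 1–5 uses the same convention for `C_□(U) = (Q′(U)G′_□²(U)Q′*(U))⁻¹`.  node00-def-Y encodes «inverse of the compression» as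
`dirInvY P T := P·(PTP + 1 − P)⁻¹·P` (`Ring.inverse`).  §1 (generic, any finite carrier `X ⊇ 𝔖`, any `𝔸`): for an operator `T` already compressed
(`𝟙_𝔖T𝟙_𝔖 = T`), a two-sided inverse `J` of `res ∘ T ∘ ext` on the functions on `𝔖` makes the padded compression a unit with inverse `ext ∘ J ∘ res + (1 − 𝟙_𝔖)`,
and `res ∘ dirInvY 𝟙_𝔖 T ∘ ext = J` (★★ `dirInvY_carrier_of_laws`).  §2 (conj-`b` form): if `Tinv` is a two-sided inverse of `conj b (r·(res∘T∘ext)|_ℝ)`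
(`r ≠ 0`) then `Tinv = conj b (r⁻¹·(res ∘ dirInvY 𝟙_𝔖 T ∘ ext)|_ℝ)` (★★★ `eq_conj_dirInvY_carrier_of_laws`, r05's `isUnit_of_conj_laws` +
`left_inv_eq_right_inv`).  §3 at the cube: def-Y's block word `X_□(Ṽ) = Q′_□(Ṽ)G′_□(Ṽ)²Q′*_□(Ṽ)` at the Dirichlet site letter `G′_□ = GpDirY … Ω₀(□)` IS
compressed to the blocks inside `Ω₀(□)` (`blkProjY_XCubeGY_blkProjY`, by the two margins of FILE `B9CubeDirichletCLetterAtOne`), hence ★★★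
`eq_CinvR_of_laws` : a two-sided inverse on `𝔖 × ι` of `conj b (η⁴·(res ∘ X_□(Ṽ) ∘ ext)|_ℝ)` IS `CinvR b i □ Ṽ`.

## Status

Printed-statement pass + proof body (proof-backed; a port in the tree's vocabulary; linear algebra): [Balaban1985BackgroundPropagators] pp. 394, 403, 409,
re-read 2026-08-31.  Honest label: the uniqueness∕compression bookkeeping that turns the engine's `Tinv` into def-Y's letter; the identification of the
engine's `G`-word inside the block word with `G′_□(Ṽ)` (n06-a `B9Cor36GpDirExtAtField.GextDirK_eq_GpDirVK`) is composed in the sequel.  Node N06 of the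
`pub-ymgap` DAG is NOT discharged here and the Yang–Mills mass gap is NOT proved here.  NEW file; nothing landed is modified.  No `sorry`, no `axiom`, no
`instance`, no `notation`.  Net new unproved facts: 0.  Cell `pub-ymgap` (HUMAN RULING D-0062), node N06 [B9], seat `pub-ymgap-dag-n06-c` (g33), 2026-08-31.
RELATED, NOT DUPLICATED (searched 2026-08-31: `rg 'dirInvY_carrier_of_laws|eq_conj_dirInvY_carrier_of_laws|blkProjY_XCubeGY_blkProjY|eq_CinvR_of_laws'` = ∅): def-Y
`Node00.OpsYCubeDirInverseBond.dirInvY_indProjY_liftOpY` (the `U = 1` lift clause; this file is its operator-level, any-`U` companion), r05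
`B9Eq359CubeKernelsAtOne.isUnit_of_conj_laws` ∕ `B9Cor35CinvAtCubeLetters.eq_conj_XinvCubeY_of_laws` (the whole-torus letter; USED BY NAME ∕ twinned).
-/

noncomputable section

namespace Literature.MathematicalPhysics.QuantumFieldTheory.Balaban1983to89.B9Cor35CDirPaddedCarrier

open B6KLevelCensusIndexV1 (KIdx kGeo)
open B6Cover236MultiLevelBlocks (cubes)
open B6Geom246MultiLevelBoxL0 (blkOf)
open B9Eq352DivFormLetters (conj)
open B9CubeLettersOpsL0 (cubeFamY)
open B9CubeLettersBondOpsL0 (BlkCubeY QpCubeY QpsCubeY)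
open B9Cor35GpCubeInputsAtOne (conj_one' eta_ne_zero)
open B9Cor36CubeSandwichQ (QpCubeY_apply_eq_zero_of QpsCubeY_apply)
open B9Eq359CubeKernelsAtOne (isUnit_of_conj_laws)
open B9Cor35GpDirInputsAtOne (dirDomY)
open B9CubeDirichletCLetterAtOne (blkOf_mem_insideBlkY)
open B9Cor35CDirCarrierAtOne (resMatY extMatY resMatY_mul_extMatY extMatY_mul_resMatY SBlk CinvR)
open Node00 (SiteY CfgY toKT liftMatY liftMatY_mul liftMatY_one liftOpY_eq_liftMatY)
open Node00.OpsYLocalInverse (dirPadY dirInvY cubeProjY cubeProjY_apply)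
open Node00.OpsYCubeDirInverse (GpDirY GpDirY_def)
open Node00.OpsYCubeDirInverseBond (indProjY indProjY_apply indProjY_mul_indProjY indProjY_eq_liftOpY)
open Node00.OpsYCubeKnitPar (parKnitCubeY)
open Node00.OpsYCubeProjectionG (insideBlkY mem_insideBlkY_iff blkProjY blkProjY_apply XCubeGY XinvCubeDY)
open scoped Matrix

/-! ## §1 The padded local inverse read on the carrier (generic) -/

section Generic

variable {𝔸 : Type} [NormedRing 𝔸] [NormedAlgebra ℂ 𝔸]
variable {X : Type} [Fintype X] [DecidableEq X] (𝔖 : Finset X)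

/-- `res♯ := (resMatY 𝔖)♯`. [cite: Balaban1985BackgroundPropagators, p.394, dictionary] -/
abbrev resOp : (X → 𝔸) →ₗ[ℂ] (↥𝔖 → 𝔸) := liftMatY 𝔸 (resMatY 𝔖)

/-- `ext♯ := (extMatY 𝔖)♯`. [cite: Balaban1985BackgroundPropagators, p.394, dictionary] -/
abbrev extOp : (↥𝔖 → 𝔸) →ₗ[ℂ] (X → 𝔸) := liftMatY 𝔸 (extMatY 𝔖)

/-- `res♯ ∘ ext♯ = 1`. [cite: Balaban1985BackgroundPropagators, p.394, bookkeeping] -/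
theorem resOp_comp_extOp : resOp (𝔸 := 𝔸) 𝔖 ∘ₗ extOp 𝔖 = LinearMap.id := by
  rw [resOp, extOp, ← liftMatY_mul, resMatY_mul_extMatY, liftMatY_one]

/-- `ext♯ ∘ res♯ = 𝟙_𝔖`. [cite: Balaban1985BackgroundPropagators, p.394, bookkeeping] -/
theorem extOp_comp_resOp : extOp (𝔸 := 𝔸) 𝔖 ∘ₗ resOp 𝔖 = indProjY 𝔖 := by
  rw [resOp, extOp, ← liftMatY_mul, extMatY_mul_resMatY, ← liftOpY_eq_liftMatY, ← indProjY_eq_liftOpY]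

/-- `𝟙_𝔖 ∘ ext♯ = ext♯`. [cite: Balaban1985BackgroundPropagators, p.394, bookkeeping] -/
theorem indProjY_comp_extOp : indProjY 𝔖 ∘ₗ extOp (𝔸 := 𝔸) 𝔖 = extOp 𝔖 := by
  rw [← extOp_comp_resOp, LinearMap.comp_assoc, resOp_comp_extOp, LinearMap.comp_id]

/-- `res♯ ∘ 𝟙_𝔖 = res♯`. [cite: Balaban1985BackgroundPropagators, p.394, bookkeeping] -/
theorem resOp_comp_indProjY : resOp (𝔸 := 𝔸) 𝔖 ∘ₗ indProjY 𝔖 = resOp 𝔖 := by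
  rw [← extOp_comp_resOp, ← LinearMap.comp_assoc, resOp_comp_extOp, LinearMap.id_comp]

variable {𝔖}

/-- a compressed operator factors through the carrier on the right: `T ∘ ext♯ = ext♯ ∘ (res♯ T ext♯)`. [cite: Balaban1985BackgroundPropagators, p.394, bookkeeping] -/
theorem comp_extOp_of_compressed {T : Module.End ℂ (X → 𝔸)} (hT : indProjY 𝔖 * T * indProjY 𝔖 = T) :
    T ∘ₗ extOp 𝔖 = extOp 𝔖 ∘ₗ (resOp 𝔖 ∘ₗ T ∘ₗ extOp 𝔖) := by
  conv_lhs => rw [← hT]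
  rw [Module.End.mul_eq_comp, Module.End.mul_eq_comp, ← extOp_comp_resOp]
  simp only [LinearMap.comp_assoc]
  rw [resOp_comp_extOp, LinearMap.comp_id]

/-- … and on the left: `res♯ ∘ T = (res♯ T ext♯) ∘ res♯`. [cite: Balaban1985BackgroundPropagators, p.394, bookkeeping] -/
theorem resOp_comp_of_compressed {T : Module.End ℂ (X → 𝔸)} (hT : indProjY 𝔖 * T * indProjY 𝔖 = T) :
    resOp 𝔖 ∘ₗ T = (resOp 𝔖 ∘ₗ T ∘ₗ extOp 𝔖) ∘ₗ resOp 𝔖 := by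
  conv_lhs => rw [← hT]
  rw [Module.End.mul_eq_comp, Module.End.mul_eq_comp, ← extOp_comp_resOp]
  simp only [← LinearMap.comp_assoc]
  rw [resOp_comp_extOp, LinearMap.id_comp]

/-- ★★ **THE PADDED LOCAL INVERSE READ ON THE CARRIER**: for `T` compressed to `𝔖` (`𝟙T𝟙 = T`) and `J` a two-sided inverse of `res♯ ∘ T ∘ ext♯`, the padded
compression `𝟙T𝟙 + (1 − 𝟙)` is a unit and `res♯ ∘ dirInvY 𝟙 T ∘ ext♯ = J`. [cite: Balaban1985BackgroundPropagators, p.394 («(Ω₀Δ′Ω₀)⁻¹ … denoted by G′»), p.409 l.1–5] -/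
theorem dirInvY_carrier_of_laws {T : Module.End ℂ (X → 𝔸)} (hT : indProjY 𝔖 * T * indProjY 𝔖 = T) {J : Module.End ℂ (↥𝔖 → 𝔸)}
    (hJ1 : (resOp 𝔖 ∘ₗ T ∘ₗ extOp 𝔖) * J = 1) (hJ2 : J * (resOp 𝔖 ∘ₗ T ∘ₗ extOp 𝔖) = 1) :
    IsUnit (dirPadY (indProjY 𝔖) T) ∧ resOp 𝔖 ∘ₗ dirInvY (indProjY 𝔖) T ∘ₗ extOp 𝔖 = J := by
  have hP2 : indProjY (𝔸 := 𝔸) 𝔖 * indProjY 𝔖 = indProjY 𝔖 := indProjY_mul_indProjY 𝔖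
  -- the padded compression is `T + (1 − 𝟙)`
  have hpad : dirPadY (indProjY 𝔖) T = T + (1 - indProjY 𝔖) := by rw [dirPadY, hT]
  -- `T(1 − 𝟙) = 0 = (1 − 𝟙)T`
  have hTP : T * indProjY 𝔖 = T := by
    conv_lhs => rw [← hT]
    rw [mul_assoc, hP2, hT]
  have hPT : indProjY 𝔖 * T = T := by
    conv_lhs => rw [← hT]
    rw [← mul_assoc, ← mul_assoc, hP2, hT]
  have hT1 : T * (1 - indProjY 𝔖) = 0 := by rw [mul_sub, mul_one, hTP, sub_self]
  have h1T : (1 - indProjY 𝔖) * T = 0 := by rw [sub_mul, one_mul, hPT, sub_self]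
  have hEE : (1 - indProjY (𝔸 := 𝔸) 𝔖) * (1 - indProjY 𝔖) = 1 - indProjY 𝔖 := by
    rw [sub_mul, one_mul, mul_sub, mul_one, hP2, sub_self, sub_zero]
  -- the candidate inverse `ext♯ J res♯ + (1 − 𝟙)`
  set C : Module.End ℂ (X → 𝔸) := extOp 𝔖 ∘ₗ J ∘ₗ resOp 𝔖 with hC
  have hTC : T * C = indProjY 𝔖 := by
    rw [hC, Module.End.mul_eq_comp, ← LinearMap.comp_assoc (J ∘ₗ resOp 𝔖) (extOp 𝔖) T, comp_extOp_of_compressed hT,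
      LinearMap.comp_assoc (J ∘ₗ resOp 𝔖) (resOp 𝔖 ∘ₗ T ∘ₗ extOp 𝔖) (extOp 𝔖),
      ← LinearMap.comp_assoc (resOp 𝔖) J (resOp 𝔖 ∘ₗ T ∘ₗ extOp 𝔖), ← Module.End.mul_eq_comp _ J, hJ1, Module.End.one_eq_id,
      LinearMap.id_comp, extOp_comp_resOp]
  have hCT : C * T = indProjY 𝔖 := by
    rw [hC, Module.End.mul_eq_comp, LinearMap.comp_assoc T (J ∘ₗ resOp 𝔖) (extOp 𝔖), LinearMap.comp_assoc T (resOp 𝔖) J,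
      resOp_comp_of_compressed hT, ← LinearMap.comp_assoc (resOp 𝔖) (resOp 𝔖 ∘ₗ T ∘ₗ extOp 𝔖) J, ← Module.End.mul_eq_comp J, hJ2,
      Module.End.one_eq_id, LinearMap.id_comp, extOp_comp_resOp]
  have hPC : indProjY 𝔖 * C = C := by
    rw [hC, Module.End.mul_eq_comp, ← LinearMap.comp_assoc (J ∘ₗ resOp 𝔖) (extOp 𝔖) (indProjY 𝔖), indProjY_comp_extOp]
  have hCP : C * indProjY 𝔖 = C := by
    rw [hC, Module.End.mul_eq_comp, LinearMap.comp_assoc (indProjY 𝔖) (J ∘ₗ resOp 𝔖) (extOp 𝔖), LinearMap.comp_assoc (indProjY 𝔖) (resOp 𝔖) J,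
      resOp_comp_indProjY]
  have hEC : (1 - indProjY 𝔖) * C = 0 := by rw [sub_mul, one_mul, hPC, sub_self]
  have hCE : C * (1 - indProjY 𝔖) = 0 := by rw [mul_sub, mul_one, hCP, sub_self]
  have hmul1 : dirPadY (indProjY 𝔖) T * (C + (1 - indProjY 𝔖)) = 1 := by
    rw [hpad, add_mul, mul_add, mul_add, hTC, hT1, hEC, hEE, add_zero, zero_add, add_sub_cancel]
  have hmul2 : (C + (1 - indProjY 𝔖)) * dirPadY (indProjY 𝔖) T = 1 := by
    rw [hpad, add_mul, mul_add, mul_add, hCT, hCE, h1T, hEE, add_zero, zero_add, add_sub_cancel]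
  have hU : IsUnit (dirPadY (indProjY 𝔖) T) := isUnit_iff_exists.2 ⟨_, hmul1, hmul2⟩
  refine ⟨hU, ?_⟩
  have hinv : Ring.inverse (dirPadY (indProjY 𝔖) T) = C + (1 - indProjY 𝔖) := by
    calc Ring.inverse (dirPadY (indProjY 𝔖) T) = (C + (1 - indProjY 𝔖)) * dirPadY (indProjY 𝔖) T * Ring.inverse (dirPadY (indProjY 𝔖) T) := by
          rw [hmul2, one_mul]
      _ = C + (1 - indProjY 𝔖) := by rw [mul_assoc, Ring.mul_inverse_cancel _ hU, mul_one]
  have hPE : indProjY (𝔸 := 𝔸) 𝔖 * (1 - indProjY 𝔖) = 0 := by rw [mul_sub, mul_one, hP2, sub_self]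
  have hdir : dirInvY (indProjY 𝔖) T = C := by
    rw [dirInvY, hinv, mul_add, add_mul, hPC, hCP, hPE, zero_mul, add_zero]
  rw [hdir, hC]
  simp only [LinearMap.comp_assoc]
  rw [resOp_comp_extOp, LinearMap.comp_id, ← LinearMap.comp_assoc J (extOp 𝔖) (resOp 𝔖), resOp_comp_extOp, LinearMap.id_comp]

end Generic

/-! ## §2 The conj-`b` form: uniqueness of the two-sided inverse -/

section Conj

variable {𝔸 : Type} [NormedRing 𝔸] [NormedAlgebra ℂ 𝔸] [CompleteSpace 𝔸]
variable {ι : Type} [Fintype ι] (b : Module.Basis ι ℝ 𝔸)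
variable {X : Type} [Fintype X] [DecidableEq X] {𝔖 : Finset X}

omit [CompleteSpace 𝔸] in
/-- ★★★ **UNIQUENESS, conj-`b` FORM**: if `Tinv` inverts `conj b (r·(res♯ T ext♯)|_ℝ)` on both sides (`r ≠ 0`, `T` compressed to `𝔖`), then the padded
compression of `T` is a unit and `Tinv = conj b (r⁻¹·(res♯ ∘ dirInvY 𝟙_𝔖 T ∘ ext♯)|_ℝ)`. [cite: Balaban1985BackgroundPropagators, p.403 l.8–12 («The inverse satisfies Theorem 3.2»), p.394, p.409 l.1–5] -/
theorem eq_conj_dirInvY_carrier_of_laws {T : Module.End ℂ (X → 𝔸)} (hT : indProjY 𝔖 * T * indProjY 𝔖 = T) {r : ℝ} (hr : r ≠ 0)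
    {Tinv : Module.End ℝ (↥𝔖 × ι → ℝ)}
    (h1 : Tinv * conj b (r • (resOp 𝔖 ∘ₗ T ∘ₗ extOp 𝔖).restrictScalars ℝ) = 1)
    (h2 : conj b (r • (resOp 𝔖 ∘ₗ T ∘ₗ extOp 𝔖).restrictScalars ℝ) * Tinv = 1) :
    IsUnit (dirPadY (indProjY 𝔖) T) ∧ Tinv = conj b (r⁻¹ • (resOp 𝔖 ∘ₗ dirInvY (indProjY 𝔖) T ∘ₗ extOp 𝔖).restrictScalars ℝ) := by
  have hunit : IsUnit (resOp 𝔖 ∘ₗ T ∘ₗ extOp 𝔖) := isUnit_of_conj_laws b _ hr Tinv h2 h1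
  obtain ⟨u, hu⟩ := hunit
  have hJ1 : (resOp 𝔖 ∘ₗ T ∘ₗ extOp 𝔖) * (↑u⁻¹ : Module.End ℂ (↥𝔖 → 𝔸)) = 1 := by rw [← hu, Units.mul_inv]
  have hJ2 : (↑u⁻¹ : Module.End ℂ (↥𝔖 → 𝔸)) * (resOp 𝔖 ∘ₗ T ∘ₗ extOp 𝔖) = 1 := by rw [← hu, Units.inv_mul]
  obtain ⟨hU, hdir⟩ := dirInvY_carrier_of_laws hT hJ1 hJ2
  refine ⟨hU, left_inv_eq_right_inv h1 ?_⟩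
  rw [← B9Eq352DivFormLetters.conj_mul, smul_mul_smul_comm, mul_inv_cancel₀ hr, one_smul, Module.End.mul_eq_comp, ← LinearMap.restrictScalars_comp,
    ← Module.End.mul_eq_comp, hdir, hJ1]
  exact conj_one' b

end Conj

/-! ## §3 At the cube: def-Y's block word is compressed to `𝔖`, so `Tinv = CinvR Ṽ` -/

section Cube

variable {d ℓ : ℕ} {hd : 1 ≤ d + 1} {hL : Odd (ℓ + 1) ∧ 1 < ℓ + 1} {b₀ b₁ : ℝ}
variable {𝔸 : Type} [NormedRing 𝔸] [NormedAlgebra ℂ 𝔸] [CompleteSpace 𝔸]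
variable {ι : Type} [Fintype ι] (b : Module.Basis ι ℝ 𝔸)
variable (i : KIdx d ℓ hd hL b₀ b₁) (c : ↥(cubes (toKT i).D.toDomains))

/-- a block of `F_□` meeting `Ω₀(□)` is in `𝔖` (member-side margin). [cite: Balaban1985BackgroundPropagators, p.409 l.1–5, bookkeeping] -/
theorem mem_SBlk_of_mem {z : SiteY i} (hz : z ∈ dirDomY i c) : blkOf (cubeFamY i c).toDomains z ∈ SBlk i c := blkOf_mem_insideBlkY i c hz

/-- `Ω₀ ∘ Q′*_□(V) = Ω₀ ∘ Q′*_□(V) ∘ 𝟙_𝔖` (the value of `Q′*λ` at a site of `Ω₀(□)` only sees `λ` on `𝔖`). [cite: Balaban1985BackgroundPropagators, (3.24)–(3.25) p.394, p.409 l.1–5] -/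
theorem cubeProjY_comp_QpsCubeY (V : CfgY 𝔸 i) :
    cubeProjY i (dirDomY i c) ∘ₗ QpsCubeY i c (parKnitCubeY i c) V =
      cubeProjY i (dirDomY i c) ∘ₗ QpsCubeY i c (parKnitCubeY i c) V ∘ₗ blkProjY i c (SBlk i c) := by
  refine LinearMap.ext fun lam => funext fun z => ?_
  simp only [LinearMap.comp_apply, cubeProjY_apply]
  split_ifs with hz
  · rw [QpsCubeY_apply, QpsCubeY_apply, blkProjY_apply, if_pos (mem_SBlk_of_mem i c hz)]
  · rfl

/-- `Q′_□(V) ∘ Ω₀ = 𝟙_𝔖 ∘ Q′_□(V) ∘ Ω₀` (a block off `𝔖` is disjoint from `Ω₀(□)`). [cite: Balaban1985BackgroundPropagators, (3.21) p.394, p.409 l.1–5] -/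
theorem QpCubeY_comp_cubeProjY (V : CfgY 𝔸 i) :
    QpCubeY i c (parKnitCubeY i c) V ∘ₗ cubeProjY i (dirDomY i c) =
      blkProjY i c (SBlk i c) ∘ₗ QpCubeY i c (parKnitCubeY i c) V ∘ₗ cubeProjY i (dirDomY i c) := by
  refine LinearMap.ext fun Λ => funext fun s => ?_
  simp only [LinearMap.comp_apply, blkProjY_apply]
  split_ifs with hs
  · rfl
  · refine QpCubeY_apply_eq_zero_of i c (parKnitCubeY i c) V _ s fun z hz => ?_
    rw [cubeProjY_apply, if_neg]
    intro hzD
    exact hs (hz ▸ mem_SBlk_of_mem i c hzD)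

/-- ★ **def-Y's BLOCK WORD AT THE DIRICHLET SITE LETTER IS COMPRESSED TO `𝔖`**: `𝟙_𝔖 · X_□(V) · 𝟙_𝔖 = X_□(V)` for
`X_□(V) = Q′_□(V)G′_□(V)²Q′*_□(V)`, `G′_□(V) = Ω₀(Ω₀Δ′Ω₀ + 1 − Ω₀)⁻¹Ω₀`. [cite: Balaban1985BackgroundPropagators, (3.25) p.394, p.394 («Ω₀Δ′_aΩ₀»), p.409 l.1–5] -/
theorem blkProjY_XCubeGY_blkProjY (V : CfgY 𝔸 i) :
    indProjY (SBlk i c) * XCubeGY i c (parKnitCubeY i c) (GpDirY i c (parKnitCubeY i c) (dirDomY i c)) V * indProjY (SBlk i c) =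
      XCubeGY i c (parKnitCubeY i c) (GpDirY i c (parKnitCubeY i c) (dirDomY i c)) V := by
  have hP : indProjY (𝔸 := 𝔸) (SBlk i c) = blkProjY i c (SBlk i c) :=
    (B9Eq3105DirichletBondLettersAtOneY.blkProjY_eq_indProjY i c (SBlk i c)).symm
  have hcP : cubeProjY (𝔸 := 𝔸) i (dirDomY i c) * cubeProjY i (dirDomY i c) = cubeProjY i (dirDomY i c) :=
    Node00.OpsYLocalInverse.cubeProjY_mul_cubeProjY i _
  -- `G′_□(V) = Ω₀ ∘ G′_□(V) ∘ Ω₀`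
  have hG : GpDirY i c (parKnitCubeY i c) (dirDomY i c) V =
      cubeProjY i (dirDomY i c) ∘ₗ GpDirY i c (parKnitCubeY i c) (dirDomY i c) V ∘ₗ cubeProjY i (dirDomY i c) := by
    rw [← Module.End.mul_eq_comp, ← Module.End.mul_eq_comp, GpDirY_def]
    simp only [← mul_assoc, hcP]
    rw [mul_assoc (cubeProjY i (dirDomY i c) * Ring.inverse _) (cubeProjY i (dirDomY i c)) (cubeProjY i (dirDomY i c)), hcP]
  have hR : cubeProjY i (dirDomY i c) ∘ₗ (QpsCubeY i c (parKnitCubeY i c) V ∘ₗ blkProjY i c (SBlk i c)) =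
      cubeProjY i (dirDomY i c) ∘ₗ QpsCubeY i c (parKnitCubeY i c) V := (cubeProjY_comp_QpsCubeY i c V).symm
  have hLft : ∀ Rm : (BlkCubeY i c → 𝔸) →ₗ[ℂ] (SiteY i → 𝔸),
      blkProjY i c (SBlk i c) ∘ₗ (QpCubeY i c (parKnitCubeY i c) V ∘ₗ (cubeProjY i (dirDomY i c) ∘ₗ Rm)) =
        QpCubeY i c (parKnitCubeY i c) V ∘ₗ (cubeProjY i (dirDomY i c) ∘ₗ Rm) := fun Rm => by
    have h := congrArg (fun F : (SiteY i → 𝔸) →ₗ[ℂ] (BlkCubeY i c → 𝔸) => F ∘ₗ Rm) (QpCubeY_comp_cubeProjY i c V)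
    simpa only [LinearMap.comp_assoc] using h.symm
  rw [hP, XCubeGY, hG]
  simp only [Module.End.mul_eq_comp, LinearMap.comp_assoc]
  rw [hR, hLft]

/-- ★★★ **`Tinv = CinvR Ṽ`**: a two-sided inverse on `𝔖 × ι` of `conj b (η⁴·(res♯ ∘ X_□(Ṽ) ∘ ext♯)|_ℝ)` IS def-Y's third cube letter at `Ṽ` read on the carrier,
print's units (FILE `B9Cor35CDirCarrierAtOne.CinvR`), and the padded compression of `X_□(Ṽ)` is a unit («The inverse satisfies Theorem 3.2», p. 403).
[cite: Balaban1985BackgroundPropagators, Thm 3.4 p.400, p.403 l.8–12, Thm 3.2 (3.48) p.398, p.409 l.1–5] -/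
theorem eq_CinvR_of_laws (V : CfgY 𝔸 i) {Tinv : Module.End ℝ (↥(SBlk i c) × ι → ℝ)}
    (h1 : Tinv * conj b (((kGeo i).eta ^ 4) • (resOp (SBlk i c) ∘ₗ XCubeGY i c (parKnitCubeY i c) (GpDirY i c (parKnitCubeY i c) (dirDomY i c)) V ∘ₗ
      extOp (SBlk i c)).restrictScalars ℝ) = 1)
    (h2 : conj b (((kGeo i).eta ^ 4) • (resOp (SBlk i c) ∘ₗ XCubeGY i c (parKnitCubeY i c) (GpDirY i c (parKnitCubeY i c) (dirDomY i c)) V ∘ₗ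
      extOp (SBlk i c)).restrictScalars ℝ) * Tinv = 1) :
    IsUnit (dirPadY (indProjY (SBlk i c)) (XCubeGY i c (parKnitCubeY i c) (GpDirY i c (parKnitCubeY i c) (dirDomY i c)) V)) ∧ Tinv = CinvR b i c V := by
  have hη4 : ((kGeo i).eta ^ 4 : ℝ) ≠ 0 := pow_ne_zero 4 (eta_ne_zero i)
  obtain ⟨hU, hT⟩ := eq_conj_dirInvY_carrier_of_laws b (blkProjY_XCubeGY_blkProjY i c V) hη4 h1 h2
  refine ⟨hU, ?_⟩
  rw [hT, CinvR]
  unfold XinvCubeDY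
  rw [B9Eq3105DirichletBondLettersAtOneY.blkProjY_eq_indProjY i c (SBlk i c)]
  rfl

end Cube

end Literature.MathematicalPhysics.QuantumFieldTheory.Balaban1983to89.B9Cor35CDirPaddedCarrier
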